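import Mathlib
import Literature.NumberTheory.Automorphic.HilbertModularFormQExpansion
import Summits.Langlands.Langlands.Theorems.CapacityClassicalityHilbertIntegralOverconvergentIsCongruenceStubFiniteQIndexAntidiagonal
import Summits.Langlands.Langlands.Theorems.CapacityClassicalityHilbertIntegralOverconvergentIsCongruenceStubFourierCoeffMul
import Summits.Langlands.Langlands.Theorems.CapacityClassicalityHilbertIntegralOverconvergentIsCongruenceStubQIndexEncoding
import Summits.Langlands.Langlands.Theorems.CapacityClassicalityHilbertIntegralOverconvergentIsCongruenceStubEncodedMul

/-!
# The `q`-expansion dictionary for Hilbert modular forms: multiplicativity along the encoding into `MvPowerSeries (Fin d) ℂ`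
# (section O endpoint)

Endpoint of RESHAPE 11 (section O) of line Sketch-ideate-r1-k1 for the crux `HilbertIntegralOverconvergentIsCongruence`
(stmt-Langlands-8485): `qExpansionDictionary` — for `F` totally real there is an encoding `idx` of the cone `qIndexSet F` of
`q`-expansion indices into `ℕ^d` (injective and additive on the cone, `stub_qIndex_encoding`, `d = [F:ℚ]`) along which, for
holomorphic `𝓞 F`-periodic `f`, `g` on `ℍ` with cone-supported Fourier coefficients, any `MvPowerSeries (Fin d) ℂ` encoding the
Fourier coefficients of `f·g` is the product of the series encoding those of `f` and of `g` (`stub_fourierCoeff_mul`: the finite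
convolution `a_ν(fg) = ∑_{μ+μ'=ν} a_μ a_{μ'}`, `stub_finite_qIndex_antidiagonal`, `stub_encoded_mul`).  This is the multiplicative
half of the dictionary that turns the graded algebra of Hilbert modular forms into a graded family of formal series closed under
products — the shape in which the landed `d`-free algebraization engine consumes it.
-/

set_option linter.dupNamespace false

noncomputable section

namespace Summit.Langlands.Langlands.Theorems.HilbertIntegralOverconvergentIsCongruence

open MeasureTheory Complex NumberField
open Literature.NumberTheory.Automorphic Literature.NumberTheory.Automorphic.HilbertModular

/-- **The `q`-expansion dictionary** (multiplicativity along the encoding): see the module docstring. [cite: Freitag1990, Ch. I §4] -/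
theorem qExpansionDictionary (F : Type) [Field F] [NumberField F] [NumberField.IsTotallyReal F] :
    ∃ (d : ℕ) (idx : F → (Fin d →₀ ℕ)), Set.InjOn idx (qIndexSet F) ∧
      (∀ μ ∈ qIndexSet F, ∀ μ' ∈ qIndexSet F, idx (μ + μ') = idx μ + idx μ') ∧
    ∀ (f g : Point F → ℂ), IsHolomorphicOn F f → IsHolomorphicOn F g →
      (∀ (a : 𝓞 F) (z : Point F), z ∈ halfSpace F → f (fun σ ↦ z σ + ((σ (a : F) : ℝ) : ℂ)) = f z) →
      (∀ (a : 𝓞 F) (z : Point F), z ∈ halfSpace F → g (fun σ ↦ z σ + ((σ (a : F) : ℝ) : ℂ)) = g z) →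
      (∀ μ : F, (∀ a : 𝓞 F, ∃ n : ℤ, Algebra.trace ℚ F (μ * a) = n) → μ ∉ qIndexSet F → fourierCoeff f μ = 0) →
      (∀ μ : F, (∀ a : 𝓞 F, ∃ n : ℤ, Algebra.trace ℚ F (μ * a) = n) → μ ∉ qIndexSet F → fourierCoeff g μ = 0) →
    ∀ (A B P : MvPowerSeries (Fin d) ℂ),
      ((∀ μ ∈ qIndexSet F, MvPowerSeries.coeff (idx μ) A = fourierCoeff f μ) ∧
        ∀ n, (∀ μ ∈ qIndexSet F, idx μ ≠ n) → MvPowerSeries.coeff n A = 0) →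
      ((∀ μ ∈ qIndexSet F, MvPowerSeries.coeff (idx μ) B = fourierCoeff g μ) ∧
        ∀ n, (∀ μ ∈ qIndexSet F, idx μ ≠ n) → MvPowerSeries.coeff n B = 0) →
      ((∀ μ ∈ qIndexSet F, MvPowerSeries.coeff (idx μ) P = fourierCoeff (f * g) μ) ∧
        ∀ n, (∀ μ ∈ qIndexSet F, idx μ ≠ n) → MvPowerSeries.coeff n P = 0) →
      P = A * B := by
  obtain ⟨d, idx, hinj, hadd⟩ := stub_qIndex_encoding F
  refine ⟨d, idx, hinj, hadd, ?_⟩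
  intro f g hf hg hperf hperg hsf hsg A B P hA hB hP
  obtain ⟨hmul, hzero⟩ := stub_encoded_mul F idx hinj hadd ℂ (fourierCoeff f) (fourierCoeff g) A B hA.1 hA.2 hB.1 hB.2
  ext n
  by_cases hn : ∃ ν ∈ qIndexSet F, idx ν = n
  · obtain ⟨ν, hν, rfl⟩ := hn
    set T : Finset (F × F) := (stub_finite_qIndex_antidiagonal F ν).toFinset with hTdef
    have hT : ∀ μ : F × F, μ ∈ T ↔ μ.1 ∈ qIndexSet F ∧ μ.2 ∈ qIndexSet F ∧ μ.1 + μ.2 = ν := fun μ ↦ by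
      rw [hTdef, Set.Finite.mem_toFinset]; rfl
    rw [hP.1 ν hν, hmul ν hν T hT]
    exact stub_fourierCoeff_mul F f g hf hg hperf hperg hsf hsg ν hν.1 T hT
  · push Not at hn
    rw [hP.2 n hn, hzero n hn]

end Summit.Langlands.Langlands.Theorems.HilbertIntegralOverconvergentIsCongruence
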